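/-
Copyright (c) 2026. Released under Apache 2.0 license as described in the file LICENSE.
-/
import Summits.RiemannHypothesis.RiemannHypothesis.Theorems.LiDirichletKernelRows
import Literature.NumberTheory.LFunctions.AutomorphicGRHProofs
import HarnessLib

/-!
# KERNEL LINEAGE K-χ — helpers for the per-modulus table files

RH-FREE.  bears_on: LADDER-RH L-D (Dirichlet rows).  WHAT THIS IS NOT: nothing here bears on the truth of RH or GRH.

Roots of unity `e(t/d)` (`rootOfUnity_eq_of_mod_eq`, `_pow`, `_mul`, `_inv`, `_eq_neg_one`, `_ne_one`), character
values at powers/products/non-units (`char_apply_pow_eq`, `char_apply_eq_zero_of_not_coprime`, `inv_char_apply`),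
primitivity for a prime modulus (`isPrimitive_of_prime`), and `rows_of_inv`: the rows of `χ̄ = χ⁻¹` are those of
`χ` (`liCoeffCharRe_inv`, `charParity_inv`, T-D2s).
-/

set_option linter.dupNamespace false

namespace Summit.RiemannHypothesis.RiemannHypothesis.Theorems.LiDirichletKernel

open Literature.NumberTheory.LFunctions Literature.NumberTheory.LFunctions.DirichletLTaylor
open Literature.NumberTheory.LFunctions.LiDirichlet
open Summit.RiemannHypothesis.RiemannHypothesis.Theorems.LiTheory
open Finset

variable {q : ℕ} [NeZero q]

/-! ## Helpers for the per-modulus files -/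

omit [NeZero q] in
/-- `e(t/d)` depends on `t mod d` only. -/
theorem rootOfUnity_eq_of_mod_eq {d t t' : ℕ} (hd : 0 < d) (h : t % d = t' % d) :
    rootOfUnity d t = rootOfUnity d t' := by
  unfold rootOfUnity
  have hd' : (d : ℂ) ≠ 0 := by exact_mod_cast hd.ne'
  have key : ∀ s : ℕ, Complex.exp (2 * Real.pi * Complex.I * ((s : ℂ) / d)) =
      Complex.exp (2 * Real.pi * Complex.I * (((s % d : ℕ) : ℂ) / d)) := by
    intro s
    conv_lhs => rw [← Nat.mod_add_div s d]
    push_cast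
    rw [show 2 * (Real.pi : ℂ) * Complex.I * ((((s % d : ℕ) : ℂ) + (d : ℂ) * ((s / d : ℕ) : ℂ)) / (d : ℂ)) =
      2 * Real.pi * Complex.I * (((s % d : ℕ) : ℂ) / d) + ((s / d : ℕ) : ℂ) * (2 * Real.pi * Complex.I) by
      field_simp, Complex.exp_add, Complex.exp_nat_mul_two_pi_mul_I, mul_one]
  rw [key t, key t', h]

omit [NeZero q] in
/-- Powers: `e(t/d)^e = e(te/d)`. -/
theorem rootOfUnity_pow (d t e : ℕ) : rootOfUnity d t ^ e = rootOfUnity d (t * e) := by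
  unfold rootOfUnity
  rw [← Complex.exp_nat_mul]
  congr 1
  push_cast
  ring

omit [NeZero q] in
/-- `e(0/d) = 1`. -/
theorem rootOfUnity_zero (d : ℕ) : rootOfUnity d 0 = 1 := by simp [rootOfUnity]

omit [NeZero q] in
/-- The value of `χ` at a power of a residue. -/
theorem char_apply_pow_eq (χ : DirichletCharacter ℂ q) {g m : ℕ} {e d k : ℕ} (hd : 0 < d)
    (hg : χ ((g : ℕ) : ZMod q) = rootOfUnity d k) (hm : ((g : ZMod q)) ^ e = (m : ZMod q)) {t : ℕ}
    (ht : (k * e) % d = t % d) : χ ((m : ℕ) : ZMod q) = rootOfUnity d t := by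
  rw [← hm, map_pow, hg, rootOfUnity_pow, rootOfUnity_eq_of_mod_eq hd ht]

omit [NeZero q] in
/-- `χ(m) = 0` at the non-units. -/
theorem char_apply_eq_zero_of_not_coprime (χ : DirichletCharacter ℂ q) {m : ℕ} (h : ¬ Nat.Coprime m q) :
    χ ((m : ℕ) : ZMod q) = 0 :=
  χ.map_nonunit (fun hu ↦ h ((ZMod.isUnit_iff_coprime m q).1 hu))

/-- For a PRIME modulus every non-principal character is primitive. -/
theorem isPrimitive_of_prime {p : ℕ} [NeZero p] (hp : p.Prime) {χ : DirichletCharacter ℂ p} (hχ : χ ≠ 1) :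
    χ.IsPrimitive := by
  rw [DirichletCharacter.isPrimitive_def]
  have hdvd := DirichletCharacter.conductor_dvd_level χ
  rcases (Nat.dvd_prime hp).1 hdvd with h1 | h1
  · exact absurd (DirichletCharacter.eq_one_iff_conductor_eq_one.2 h1) hχ
  · exact h1

omit [NeZero q] in
/-- Products: `e(a/d)·e(b/d) = e((a+b)/d)`. -/
theorem rootOfUnity_mul (d a b : ℕ) : rootOfUnity d a * rootOfUnity d b = rootOfUnity d (a + b) := by
  unfold rootOfUnity
  rw [← Complex.exp_add]
  congr 1
  push_cast
  ring

omit [NeZero q] in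
/-- Inverses: `e(t/d)⁻¹ = e((d−t)/d)` (`t ≤ d`). -/
theorem rootOfUnity_inv {d t : ℕ} (hd : 0 < d) (ht : t ≤ d) : (rootOfUnity d t)⁻¹ = rootOfUnity d (d - t) := by
  have h : rootOfUnity d t * rootOfUnity d (d - t) = 1 := by
    rw [rootOfUnity_mul, show t + (d - t) = d by omega, rootOfUnity_eq_of_mod_eq hd (t' := 0) (by simp),
      rootOfUnity_zero]
  exact inv_eq_of_mul_eq_one_right h

omit [NeZero q] in
/-- `e(t/d) = −1` when `2t = d`. -/
theorem rootOfUnity_eq_neg_one {d t : ℕ} (h : 2 * t = d) (ht : 0 < t) : rootOfUnity d t = -1 := by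
  unfold rootOfUnity
  have ht' : (t : ℂ) ≠ 0 := by exact_mod_cast ht.ne'
  rw [← h, show 2 * (Real.pi : ℂ) * Complex.I * ((t : ℂ) / ((2 * t : ℕ) : ℂ)) = Real.pi * Complex.I by
    push_cast; field_simp]
  exact Complex.exp_pi_mul_I

omit [NeZero q] in
/-- `e(t/d) ≠ 1` for `0 < t < d`. -/
theorem rootOfUnity_ne_one {d t : ℕ} (ht : 0 < t) (htd : t < d) : rootOfUnity d t ≠ 1 := by
  intro h
  rw [rootOfUnity, Complex.exp_eq_one_iff] at h
  obtain ⟨n, hn⟩ := h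
  have hd : (d : ℂ) ≠ 0 := by exact_mod_cast (show d ≠ 0 by omega)
  have h2 : (2 * (Real.pi : ℂ) * Complex.I) ≠ 0 := by simp [Real.pi_ne_zero, Complex.I_ne_zero]
  have key : (t : ℂ) = n * d := by
    have := hn
    field_simp at this
    linear_combination this
  have keyR : (t : ℝ) = n * d := by
    have := congrArg Complex.re key
    simpa [Complex.mul_re] using this
  rcases le_or_gt n 0 with hn0 | hn0
  · have : (t : ℝ) ≤ 0 := by rw [keyR]; exact mul_nonpos_of_nonpos_of_nonneg (by exact_mod_cast hn0) (by positivity)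
    have : (0 : ℝ) < t := by exact_mod_cast ht
    linarith
  · have : (d : ℝ) ≤ t := by
      rw [keyR]
      have : (1 : ℝ) ≤ n := by exact_mod_cast hn0
      nlinarith [(Nat.cast_nonneg d : (0 : ℝ) ≤ d)]
    have : (t : ℝ) < d := by exact_mod_cast htd
    linarith

omit [NeZero q] in
/-- `χ⁻¹` at a residue where `χ` is `e(t/d)`. -/
theorem inv_char_apply (χ : DirichletCharacter ℂ q) {m d t : ℕ} (hd : 0 < d) (ht : t ≤ d)
    (h : χ ((m : ℕ) : ZMod q) = rootOfUnity d t) : χ⁻¹ ((m : ℕ) : ZMod q) = rootOfUnity d (d - t) := by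
  rw [MulChar.inv_apply_eq_inv', h, rootOfUnity_inv hd ht]

/-- A primitive character modulo `q ≥ 2` is non-principal. -/
theorem ne_one_of_isPrimitive' {χ : DirichletCharacter ℂ q} (hχ : χ.IsPrimitive) (hq : 1 < q) : χ ≠ 1 := by
  intro h
  have h1 : χ.conductor = q := hχ
  rw [h, DirichletCharacter.conductor_one] at h1
  omega

/-- **Conjugate characters have the same rows**: the `λ`- and `lt`-rows of `χ⁻¹` are those of `χ` (primitive `χ`,
`q > 1`; `liCoeffCharRe_inv`, `charParity_inv` and T-D2s). -/
theorem rows_of_inv {χ : DirichletCharacter ℂ q} (hprim : χ.IsPrimitive) (hq : 1 < q) {n : ℕ} (hn : 1 ≤ n)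
    {d : ℕ} {l₁ h₁ l₂ h₂ : ℤ}
    (h : InRow (liCoeffCharRe χ⁻¹ n) d l₁ h₁ ∧ InRow (charLiOsc χ⁻¹ n) d l₂ h₂ ∧ 0 < liCoeffCharRe χ⁻¹ n) :
    InRow (liCoeffCharRe χ n) d l₁ h₁ ∧ InRow (charLiOsc χ n) d l₂ h₂ ∧ 0 < liCoeffCharRe χ n := by
  have h1 : χ ≠ 1 := ne_one_of_isPrimitive' hprim hq
  have hinv : χ⁻¹.IsPrimitive := AutomorphicGRHOne.isPrimitive_inv hprim
  have hre : liCoeffCharRe χ⁻¹ n = liCoeffCharRe χ n := DirichletTheta.liCoeffCharRe_inv h1 n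
  have htr : charLiTrend χ⁻¹ n = charLiTrend χ n := by
    unfold charLiTrend charTrendGen
    rw [DirichletTheta.charParity_inv]
  have hs := liDirichletSplit_holds q χ hprim hq n hn
  have hs' := liDirichletSplit_holds q χ⁻¹ hinv hq n hn
  have hosc : charLiOsc χ⁻¹ n = charLiOsc χ n := by linarith
  rw [hre, hosc] at h
  exact h

end Summit.RiemannHypothesis.RiemannHypothesis.Theorems.LiDirichletKernel
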